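import Literature.MathematicalPhysics.QuantumLattice.LiebRobinsonHastingsKomaSpectralProofs
import Literature.MathematicalPhysics.QuantumLattice.SpinOperatorsProofs
import Mathlib.Analysis.SpecialFunctions.Trigonometric.Bounds
import HarnessLib

/-!
# Approximate eigenvectors: the elementary lemmas behind the many-body charge-transport index

Bachmann–Bols–De Roeck–Fraas, *A many-body index for quantum charge transport*, Comm. Math.
Phys. **375** (2019) 1249–1272 (BBDF), §4.1 ("Approximate eigenvectors") and the scalar steps of
§§4.3–4.4, for vectors `ψ : n → ℂ` and matrices acting by `mulVec` (the variance
`Var_ψ(A) = ‖(A - ⟨ψ,Aψ⟩)ψ‖²` is handled through the Euclidean norm `eucNorm` of `(A - a)ψ`).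
Everything is PROVED (no named facts):

* `eucNorm` (the norm of `EuclideanSpace ℂ n`) and its algebra: Cauchy–Schwarz
  `norm_star_dotProduct_le`, the operator bound `eucNorm_mulVec_le` (`‖Aψ‖₂ ≤ ‖A‖‖ψ‖₂`, Mathlib
  `Matrix.l2_opNorm_mulVec`), isometries `eucNorm_mulVec_of_conjTranspose_mul_self`.
* BBDF Lemma 4.1 (products): `eucNorm_mul_mulVec_sub_le`, `norm_expect_sub_le`.
* BBDF eq. (4.2) and Lemma 4.2 (the algebra, with the clustering bound as a hypothesis `c`):
  `eucNorm_unitary_sub_expect_sq` (`‖Uψ - ⟨U⟩ψ‖₂² = 1 - |⟨U⟩|²`), `one_sub_norm_expect_sq_le`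
  (`Var(W₁) ≤ Var(W₁W₂) + 2c`).
* BBDF Lemma 4.3 for `f = e^{iφ·}`: `eucNorm_exp_mulVec_sub_le`
  (`‖(e^{iφX} - e^{iφa})ψ‖₂ ≤ |φ|‖(X - a)ψ‖₂`, Hermitian `X`; mean value inequality for
  `u ↦ e^{iuY}ψ`).
* The quantization step of §4.4: `exists_int_abs_sub_le_norm_cexp_sub_one`
  (`dist(x, ℤ) ≤ ‖e^{2πix} - 1‖/4`), and the comparison lemma of the proof of Lemma 4.5,
  `norm_sub_cexp_mul_le_of_hasDerivAt` (`χ' = iaχ + O(E) ⟹ χ(Φ) = e^{iaΦ}χ(0) + O(EΦ)`).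
* Symmetry and exponential algebra used in §4.4: `expect_conjTranspose_mul_mul`
  (`⟨Uᴴ X U⟩ = ⟨X⟩` if `Uψ = λψ`), `conjTranspose_mul_exp_mul` (`Uᴴ e^X U = e^{UᴴXU}`),
  `exp_smul_of_mul_self_eq` (`P² = P ⟹ e^{cP} = 1 + (e^c - 1)P`), hence `e^{2πiP} = 1`
  (`exp_two_pi_I_smul_of_mul_self_eq`: integer spectrum of the charges).

Deliberately NOT here: clustering itself (BBDF Assumption (v); separate file), the quasi-adiabatic
generator (`QuasiAdiabaticGenerator.lean`), and anything lattice-specific.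

## References

* S. Bachmann, A. Bols, W. De Roeck, M. Fraas, Comm. Math. Phys. **375** (2019) 1249, §4.1
  (Lemmas 4.1–4.3, eq. (4.2)), §4.3 (proof of Lemma 4.5), §4.4. [BachmannEtAl2019]
* Mathlib: `Matrix.l2_opNorm_mulVec`, `norm_inner_le_norm`,
  `Convex.norm_image_sub_le_of_norm_hasDerivWithin_le`, `hasDerivAt_exp_smul_const'`,
  `Matrix.exp_conj'`, the tree's `exp_smul_one_eq` (SpinOperatorsProofs), `Complex.norm_exp_I_mul_ofReal_sub_one`,
  `Real.mul_le_sin` (Jordan), `abs_sub_round`; the tree: `hasDerivAt_exp_smul_left`,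
  `exp_smul_mem_unitary`, `norm_toLp_eq_one_of_dotProduct`.
-/

noncomputable section

open Matrix Complex Finset
open scoped Matrix.Norms.L2Operator ComplexOrder InnerProductSpace Real

namespace Literature.MathematicalPhysics.QuantumLattice

variable {n : Type*} [Fintype n] [DecidableEq n]

/-! ### The Euclidean norm of a coordinate vector -/

/-- The Euclidean norm `‖v‖₂` of `v : n → ℂ` (the norm of `v` in `EuclideanSpace ℂ n`). [folklore] -/
def eucNorm (v : n → ℂ) : ℝ := ‖(WithLp.toLp 2 v : EuclideanSpace ℂ n)‖

omit [DecidableEq n] in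
/-- `‖v‖₂ ≥ 0`. [folklore] -/
theorem eucNorm_nonneg (v : n → ℂ) : 0 ≤ eucNorm v := norm_nonneg _

omit [DecidableEq n] in
/-- `‖v‖₂² = Re (v⋆ · v)`. [folklore] -/
theorem eucNorm_sq (v : n → ℂ) : eucNorm v ^ 2 = (star v ⬝ᵥ v).re := by
  rw [eucNorm, @norm_sq_eq_re_inner ℂ, EuclideanSpace.inner_toLp_toLp, dotProduct_comm]
  rfl

omit [DecidableEq n] in
/-- `v⋆ · v = ‖v‖₂²` as a complex number. [folklore] -/
theorem star_dotProduct_self_eq_eucNorm_sq (v : n → ℂ) : star v ⬝ᵥ v = ((eucNorm v ^ 2 : ℝ) : ℂ) := by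
  have h : star v ⬝ᵥ v = (inner ℂ (WithLp.toLp 2 v : EuclideanSpace ℂ n) (WithLp.toLp 2 v)) := by
    rw [EuclideanSpace.inner_toLp_toLp, dotProduct_comm]
  rw [h, eucNorm, inner_self_eq_norm_sq_to_K]
  norm_cast

omit [DecidableEq n] in
/-- A normalised vector has Euclidean norm one. [folklore] -/
theorem eucNorm_eq_one {ψ : n → ℂ} (hψ1 : star ψ ⬝ᵥ ψ = 1) : eucNorm ψ = 1 :=
  norm_toLp_eq_one_of_dotProduct hψ1

omit [DecidableEq n] in
/-- `‖c v‖₂ = |c| ‖v‖₂`. [folklore] -/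
theorem eucNorm_smul (c : ℂ) (v : n → ℂ) : eucNorm (c • v) = ‖c‖ * eucNorm v := by
  rw [eucNorm, eucNorm, ← norm_smul]
  rfl

omit [DecidableEq n] in
/-- `‖-v‖₂ = ‖v‖₂`. [folklore] -/
theorem eucNorm_neg (v : n → ℂ) : eucNorm (-v) = eucNorm v := by
  unfold eucNorm
  rw [WithLp.toLp_neg, norm_neg]

omit [DecidableEq n] in
/-- Triangle inequality. [folklore] -/
theorem eucNorm_add_le (v w : n → ℂ) : eucNorm (v + w) ≤ eucNorm v + eucNorm w := by
  unfold eucNorm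
  exact norm_add_le (WithLp.toLp 2 v : EuclideanSpace ℂ n) (WithLp.toLp 2 w)

omit [DecidableEq n] in
/-- Triangle inequality for differences. [folklore] -/
theorem eucNorm_sub_le (v w : n → ℂ) : eucNorm (v - w) ≤ eucNorm v + eucNorm w := by
  unfold eucNorm
  exact norm_sub_le (WithLp.toLp 2 v : EuclideanSpace ℂ n) (WithLp.toLp 2 w)

omit [DecidableEq n] in
/-- `‖v - w‖₂ = ‖w - v‖₂`. [folklore] -/
theorem eucNorm_sub_comm (v w : n → ℂ) : eucNorm (v - w) = eucNorm (w - v) := by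
  rw [← eucNorm_neg, neg_sub]

omit [DecidableEq n] in
/-- `‖0‖₂ = 0`. [folklore] -/
@[simp] theorem eucNorm_zero : eucNorm (0 : n → ℂ) = 0 := by
  rw [eucNorm]; exact norm_zero

omit [DecidableEq n] in
/-- **Cauchy–Schwarz**: `|u⋆ · v| ≤ ‖u‖₂ ‖v‖₂`. [folklore] -/
theorem norm_star_dotProduct_le (u v : n → ℂ) : ‖star u ⬝ᵥ v‖ ≤ eucNorm u * eucNorm v := by
  have h := norm_inner_le_norm (𝕜 := ℂ) (WithLp.toLp 2 u : EuclideanSpace ℂ n) (WithLp.toLp 2 v)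
  rw [EuclideanSpace.inner_toLp_toLp, dotProduct_comm] at h
  exact h

/-- **Operator norm bound**: `‖A v‖₂ ≤ ‖A‖ ‖v‖₂`. [folklore] -/
theorem eucNorm_mulVec_le (A : Matrix n n ℂ) (v : n → ℂ) : eucNorm (A *ᵥ v) ≤ ‖A‖ * eucNorm v :=
  Matrix.l2_opNorm_mulVec A (WithLp.toLp 2 v : EuclideanSpace ℂ n)

/-- An isometry preserves the Euclidean norm: `Uᴴ U = 1 ⟹ ‖U v‖₂ = ‖v‖₂`. [folklore] -/
theorem eucNorm_mulVec_of_conjTranspose_mul_self {U : Matrix n n ℂ} (hU : Uᴴ * U = 1)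
    (v : n → ℂ) : eucNorm (U *ᵥ v) = eucNorm v := by
  have h : star (U *ᵥ v) ⬝ᵥ (U *ᵥ v) = star v ⬝ᵥ v := by
    rw [star_mulVec, ← dotProduct_mulVec, mulVec_mulVec, hU, one_mulVec]
  have h1 : eucNorm (U *ᵥ v) ^ 2 = eucNorm v ^ 2 := by
    rw [eucNorm_sq, eucNorm_sq, h]
  nlinarith [eucNorm_nonneg (U *ᵥ v), eucNorm_nonneg v, h1]

/-! ### Expectations and approximate eigenvectors -/

omit [DecidableEq n] in
/-- `|ψ⋆ · v| ≤ ‖v‖₂` for a unit vector `ψ`. [folklore] -/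
theorem norm_star_dotProduct_le_eucNorm {ψ : n → ℂ} (hψ1 : star ψ ⬝ᵥ ψ = 1) (v : n → ℂ) :
    ‖star ψ ⬝ᵥ v‖ ≤ eucNorm v := by
  have h := norm_star_dotProduct_le ψ v
  rwa [eucNorm_eq_one hψ1, one_mul] at h

omit [DecidableEq n] in
/-- **An approximate eigenvalue is close to the expectation**: for a unit vector `ψ`,
`|⟨ψ, Xψ⟩ - x| ≤ ‖(X - x)ψ‖₂`. [folklore] -/
theorem norm_expect_sub_le {ψ : n → ℂ} (hψ1 : star ψ ⬝ᵥ ψ = 1) (X : Matrix n n ℂ) (x : ℂ) :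
    ‖star ψ ⬝ᵥ (X *ᵥ ψ) - x‖ ≤ eucNorm (X *ᵥ ψ - x • ψ) := by
  have e : star ψ ⬝ᵥ (X *ᵥ ψ) - x = star ψ ⬝ᵥ (X *ᵥ ψ - x • ψ) := by
    rw [dotProduct_sub, dotProduct_smul, hψ1, smul_eq_mul, mul_one]
  rw [e]
  exact norm_star_dotProduct_le_eucNorm hψ1 _

/-- **Products of approximate eigen-operators** (BBDF Lemma 4.1, one step):
`‖ABψ - ab ψ‖₂ ≤ ‖A‖ ‖Bψ - bψ‖₂ + |b| ‖Aψ - aψ‖₂`. [cite: BachmannEtAl2019, Lemma 4.1] -/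
theorem eucNorm_mul_mulVec_sub_le (A B : Matrix n n ℂ) (ψ : n → ℂ) (a b : ℂ) :
    eucNorm ((A * B) *ᵥ ψ - (a * b) • ψ) ≤
      ‖A‖ * eucNorm (B *ᵥ ψ - b • ψ) + ‖b‖ * eucNorm (A *ᵥ ψ - a • ψ) := by
  have e : (A * B) *ᵥ ψ - (a * b) • ψ = A *ᵥ (B *ᵥ ψ - b • ψ) + b • (A *ᵥ ψ - a • ψ) := by
    rw [← mulVec_mulVec, mulVec_sub, mulVec_smul, smul_sub, smul_smul, mul_comm b a]
    abel
  rw [e]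
  refine (eucNorm_add_le _ _).trans (add_le_add (eucNorm_mulVec_le _ _) ?_)
  rw [eucNorm_smul]

/-- **The variance of a unitary** (BBDF eq. (4.2)): for `Uᴴ U = 1` and a unit vector `ψ`,
`‖Uψ - ⟨ψ,Uψ⟩ψ‖₂² = 1 - |⟨ψ,Uψ⟩|²`. [cite: BachmannEtAl2019, Eq. (4.2)] -/
theorem eucNorm_unitary_sub_expect_sq {U : Matrix n n ℂ} (hU : Uᴴ * U = 1) {ψ : n → ℂ}
    (hψ1 : star ψ ⬝ᵥ ψ = 1) :
    eucNorm (U *ᵥ ψ - (star ψ ⬝ᵥ (U *ᵥ ψ)) • ψ) ^ 2 = 1 - ‖star ψ ⬝ᵥ (U *ᵥ ψ)‖ ^ 2 := by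
  set e : ℂ := star ψ ⬝ᵥ (U *ᵥ ψ) with he
  have hUU : star (U *ᵥ ψ) ⬝ᵥ (U *ᵥ ψ) = 1 := by
    rw [star_mulVec, ← dotProduct_mulVec, mulVec_mulVec, hU, one_mulVec, hψ1]
  have h1 : star (U *ᵥ ψ) ⬝ᵥ ψ = starRingEnd ℂ e := by
    rw [he, star_dotProduct]
    rfl
  have hexp : star (U *ᵥ ψ - e • ψ) ⬝ᵥ (U *ᵥ ψ - e • ψ) = 1 - starRingEnd ℂ e * e := by
    rw [star_sub, star_smul, sub_dotProduct, dotProduct_sub, dotProduct_sub, smul_dotProduct,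
      smul_dotProduct, dotProduct_smul, dotProduct_smul, hUU, h1, ← he, hψ1]
    simp only [smul_eq_mul, mul_one, Complex.star_def]
    ring
  have h2 := star_dotProduct_self_eq_eucNorm_sq (U *ᵥ ψ - e • ψ)
  rw [hexp] at h2
  have h3 : starRingEnd ℂ e * e = ((‖e‖ ^ 2 : ℝ) : ℂ) := by
    rw [Complex.conj_mul', ← Complex.ofReal_pow]
  rw [h3] at h2
  have := congrArg Complex.re h2
  simp only [Complex.sub_re, Complex.one_re, Complex.ofReal_re] at this
  linarith

/-- The expectation of an isometry in a unit vector has modulus `≤ 1`. [folklore] -/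
theorem norm_expect_le_one_of_conjTranspose_mul_self {W : Matrix n n ℂ} (hW : Wᴴ * W = 1)
    {ψ : n → ℂ} (hψ1 : star ψ ⬝ᵥ ψ = 1) : ‖star ψ ⬝ᵥ (W *ᵥ ψ)‖ ≤ 1 := by
  have h := norm_star_dotProduct_le_eucNorm hψ1 (W *ᵥ ψ)
  rwa [eucNorm_mulVec_of_conjTranspose_mul_self hW, eucNorm_eq_one hψ1] at h

/-- **BBDF Lemma 4.2 (the algebra)**: if `W = W₁W₂` with `W₁`, `W₂` isometries, `ψ` a unit vector
and `|⟨W₁W₂⟩ - ⟨W₁⟩⟨W₂⟩| ≤ c` (clustering), then `1 - |⟨W₁⟩|² ≤ (1 - |⟨W₁W₂⟩|²) + 2c`, i.e.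
`Var(W₁) ≤ Var(W) + 2c`. [cite: BachmannEtAl2019, Lemma 4.2] -/
theorem one_sub_norm_expect_sq_le {W₁ W₂ : Matrix n n ℂ} (hW₁ : W₁ᴴ * W₁ = 1) (hW₂ : W₂ᴴ * W₂ = 1)
    {ψ : n → ℂ} (hψ1 : star ψ ⬝ᵥ ψ = 1) {c : ℝ}
    (hc : ‖star ψ ⬝ᵥ ((W₁ * W₂) *ᵥ ψ) - (star ψ ⬝ᵥ (W₁ *ᵥ ψ)) * (star ψ ⬝ᵥ (W₂ *ᵥ ψ))‖ ≤ c) :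
    1 - ‖star ψ ⬝ᵥ (W₁ *ᵥ ψ)‖ ^ 2 ≤ (1 - ‖star ψ ⬝ᵥ ((W₁ * W₂) *ᵥ ψ)‖ ^ 2) + 2 * c := by
  set x := ‖star ψ ⬝ᵥ ((W₁ * W₂) *ᵥ ψ)‖ with hx
  set x₁ := ‖star ψ ⬝ᵥ (W₁ *ᵥ ψ)‖ with hx₁
  have hx₂ : ‖star ψ ⬝ᵥ (W₂ *ᵥ ψ)‖ ≤ 1 := norm_expect_le_one_of_conjTranspose_mul_self hW₂ hψ1
  have hx₁1 : x₁ ≤ 1 := norm_expect_le_one_of_conjTranspose_mul_self hW₁ hψ1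
  have hW : (W₁ * W₂)ᴴ * (W₁ * W₂) = 1 := by
    rw [conjTranspose_mul, Matrix.mul_assoc, ← Matrix.mul_assoc W₁ᴴ, hW₁, Matrix.one_mul, hW₂]
  have hx1 : x ≤ 1 := norm_expect_le_one_of_conjTranspose_mul_self hW hψ1
  have hxle : x ≤ c + x₁ := by
    calc x ≤ ‖star ψ ⬝ᵥ ((W₁ * W₂) *ᵥ ψ) - (star ψ ⬝ᵥ (W₁ *ᵥ ψ)) * (star ψ ⬝ᵥ (W₂ *ᵥ ψ))‖ +
          ‖(star ψ ⬝ᵥ (W₁ *ᵥ ψ)) * (star ψ ⬝ᵥ (W₂ *ᵥ ψ))‖ := norm_le_norm_sub_add _ _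
      _ ≤ c + x₁ * 1 := add_le_add hc (by
          rw [norm_mul]; exact mul_le_mul_of_nonneg_left hx₂ (norm_nonneg _))
      _ = c + x₁ := by ring
  have hc0 : 0 ≤ c := (norm_nonneg _).trans hc
  have hx0 : 0 ≤ x := norm_nonneg _
  have hx₁0 : 0 ≤ x₁ := norm_nonneg _
  -- `x² - x₁² = (x - x₁)(x + x₁) ≤ c · 2`
  nlinarith [mul_le_mul_of_nonneg_right hxle (by linarith : (0:ℝ) ≤ x + x₁)]

/-! ### Exponentials of Hermitian operators on approximate eigenvectors (BBDF Lemma 4.3) -/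

/-- The map `M ↦ M ψ` into `EuclideanSpace ℂ n`, as a continuous linear map. [folklore] -/
def mulVecEucCLM (ψ : n → ℂ) : Matrix n n ℂ →L[ℂ] EuclideanSpace ℂ n :=
  LinearMap.toContinuousLinearMap
    { toFun := fun M => WithLp.toLp 2 (M *ᵥ ψ)
      map_add' := fun M N => by rw [add_mulVec, WithLp.toLp_add]
      map_smul' := fun c M => by rw [smul_mulVec, WithLp.toLp_smul, RingHom.id_apply] }

omit [DecidableEq n] in
/-- Values of `mulVecEucCLM`. [folklore] -/
@[simp] theorem mulVecEucCLM_apply (ψ : n → ℂ) (M : Matrix n n ℂ) :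
    mulVecEucCLM ψ M = WithLp.toLp 2 (M *ᵥ ψ) := rfl

omit [Fintype n] [DecidableEq n] in
/-- Real scalar form of `(I u) • X`: `(I u) • X = u • (I • X)`. [folklore] -/
theorem I_mul_ofReal_smul (u : ℝ) (X : Matrix n n ℂ) :
    ((I * (u : ℂ)) • X : Matrix n n ℂ) = (u : ℝ) • ((I : ℂ) • X) := by
  rw [mul_comm, mul_smul, Complex.coe_smul]

/-- `e^{iuY}` is unitary for Hermitian `Y` and real `u` (`(e^{u(iY)})ᴴ e^{u(iY)} = 1`). [folklore] -/
theorem conjTranspose_exp_real_smul_mul_self {Y : Matrix n n ℂ} (hY : Y.IsHermitian) (u : ℝ) :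
    (NormedSpace.exp ((u : ℝ) • ((I : ℂ) • Y)))ᴴ * NormedSpace.exp ((u : ℝ) • ((I : ℂ) • Y)) = 1 := by
  rw [← I_mul_ofReal_smul]
  have h := exp_smul_mem_unitary hY (c := I * (u : ℂ)) (by simp)
  exact Unitary.star_mul_self_of_mem h

/-- **Duhamel/mean-value bound for `e^{iφY} - 1` on a vector**: for Hermitian `Y`,
`‖(e^{iφY} - 1)ψ‖₂ ≤ |φ| ‖Yψ‖₂`. [folklore] -/
theorem eucNorm_exp_mulVec_sub_self_le {Y : Matrix n n ℂ} (hY : Y.IsHermitian) (ψ : n → ℂ) (φ : ℝ) :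
    eucNorm (NormedSpace.exp ((I * (φ : ℂ)) • Y) *ᵥ ψ - ψ) ≤ |φ| * eucNorm (Y *ᵥ ψ) := by
  set K : Matrix n n ℂ := (I : ℂ) • Y with hK
  set f : ℝ → EuclideanSpace ℂ n := fun u => WithLp.toLp 2 (NormedSpace.exp ((u : ℝ) • K) *ᵥ ψ) with hf
  have hderiv : ∀ u : ℝ, HasDerivAt f (WithLp.toLp 2 ((K * NormedSpace.exp ((u : ℝ) • K)) *ᵥ ψ)) u := by
    intro u
    have h := ((mulVecEucCLM ψ).restrictScalars ℝ).hasFDerivAt.comp_hasDerivAt u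
      (hasDerivAt_exp_smul_left K u)
    simp only [Function.comp_def, ContinuousLinearMap.coe_restrictScalars', mulVecEucCLM_apply] at h
    exact h
  have hbound : ∀ u : ℝ, ‖WithLp.toLp 2 ((K * NormedSpace.exp ((u : ℝ) • K)) *ᵥ ψ)‖ = eucNorm (Y *ᵥ ψ) := by
    intro u
    have hcomm : K * NormedSpace.exp ((u : ℝ) • K) = NormedSpace.exp ((u : ℝ) • K) * K :=
      (((Commute.refl K).smul_right (u : ℝ)).exp_right).eq
    rw [hcomm, ← mulVec_mulVec]
    change eucNorm (NormedSpace.exp ((u : ℝ) • K) *ᵥ (K *ᵥ ψ)) = _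
    rw [eucNorm_mulVec_of_conjTranspose_mul_self (conjTranspose_exp_real_smul_mul_self hY u), hK,
      smul_mulVec, eucNorm_smul, Complex.norm_I, one_mul]
  have hMVT := Convex.norm_image_sub_le_of_norm_hasDerivWithin_le (f := f) (s := Set.univ)
    (C := eucNorm (Y *ᵥ ψ)) (fun u _ => (hderiv u).hasDerivWithinAt)
    (fun u _ => (hbound u).le) convex_univ (Set.mem_univ 0) (Set.mem_univ φ)
  have hf0 : f 0 = WithLp.toLp 2 ψ := by simp [hf]
  have hfφ : f φ = WithLp.toLp 2 (NormedSpace.exp ((I * (φ : ℂ)) • Y) *ᵥ ψ) := by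
    rw [I_mul_ofReal_smul]
  rw [hf0, hfφ, ← WithLp.toLp_sub, sub_zero, Real.norm_eq_abs] at hMVT
  rw [mul_comm (|φ|) (eucNorm _)]
  exact hMVT

/-- **BBDF Lemma 4.3 for `f(x) = e^{iφx}`**: for Hermitian `X`, real `a`, `φ` and any `ψ`,
`‖(e^{iφX} - e^{iφa})ψ‖₂ ≤ |φ| ‖(X - a)ψ‖₂` — an approximate eigenvector of `X` is an approximate
eigenvector of `e^{iφX}`. [cite: BachmannEtAl2019, Lemma 4.3] -/
theorem eucNorm_exp_mulVec_sub_le {X : Matrix n n ℂ} (hX : X.IsHermitian) (ψ : n → ℂ) (a φ : ℝ) :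
    eucNorm (NormedSpace.exp ((I * (φ : ℂ)) • X) *ᵥ ψ - cexp (I * φ * a) • ψ) ≤
      |φ| * eucNorm (X *ᵥ ψ - (a : ℂ) • ψ) := by
  set Y : Matrix n n ℂ := X - (a : ℂ) • 1 with hY
  have hYh : Y.IsHermitian := by
    rw [hY]
    refine hX.sub ?_
    unfold Matrix.IsHermitian
    rw [conjTranspose_smul, conjTranspose_one, Complex.star_def, Complex.conj_ofReal]
  have hsplit : ((I * (φ : ℂ)) • X : Matrix n n ℂ) = (I * φ * a) • (1 : Matrix n n ℂ) + (I * (φ : ℂ)) • Y := by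
    rw [hY, smul_sub, smul_smul]
    abel
  have hcomm : Commute ((I * φ * a) • (1 : Matrix n n ℂ)) ((I * (φ : ℂ)) • Y) :=
    ((Commute.one_left Y).smul_left _).smul_right _
  have hexp : NormedSpace.exp ((I * (φ : ℂ)) • X) = cexp (I * φ * a) • NormedSpace.exp ((I * (φ : ℂ)) • Y) := by
    rw [hsplit, Matrix.exp_add_of_commute _ _ hcomm, exp_smul_one_eq, smul_mul_assoc, Matrix.one_mul]
  have e : NormedSpace.exp ((I * (φ : ℂ)) • X) *ᵥ ψ - cexp (I * φ * a) • ψ =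
      cexp (I * φ * a) • (NormedSpace.exp ((I * (φ : ℂ)) • Y) *ᵥ ψ - ψ) := by
    rw [hexp, smul_mulVec]
    exact (smul_sub _ _ _).symm
  have hYψ : Y *ᵥ ψ = X *ᵥ ψ - (a : ℂ) • ψ := by
    rw [hY, sub_mulVec, smul_mulVec, one_mulVec]
  rw [e, eucNorm_smul, ← hYψ]
  have hnorm : ‖cexp (I * φ * a)‖ = 1 := by
    have : (I * φ * a : ℂ) = ((φ * a : ℝ) : ℂ) * I := by push_cast; ring
    rw [this, Complex.norm_exp_ofReal_mul_I]
  rw [hnorm, one_mul]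
  exact eucNorm_exp_mulVec_sub_self_le hYh ψ φ

/-! ### Quantization: a phase close to one forces an index close to an integer -/

/-- **`|e^{2πix} - 1| ≥ 4 dist(x, ℤ)`**: there is an integer `m` with `|x - m| ≤ ‖e^{2πix} - 1‖/4`
(`‖e^{iθ} - 1‖ = 2|sin(θ/2)|` and Jordan's inequality `sin y ≥ 2y/π` on `[0, π/2]`). [folklore] -/
theorem exists_int_abs_sub_le_norm_cexp_sub_one (x : ℝ) :
    ∃ m : ℤ, |x - m| ≤ ‖cexp (2 * π * I * x) - 1‖ / 4 := by
  refine ⟨round x, ?_⟩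
  set y : ℝ := x - round x with hy
  have hyb : |y| ≤ 1 / 2 := abs_sub_round x
  -- periodicity: `e^{2πix} = e^{2πiy}`
  have hper : cexp (2 * π * I * x) = cexp (2 * π * I * y) := by
    have e : (2 * π * I * x : ℂ) = 2 * π * I * y + (round x : ℤ) * (2 * π * I) := by
      rw [hy]; push_cast; ring
    rw [e, Complex.exp_add, Complex.exp_int_mul_two_pi_mul_I, mul_one]
  rw [hper]
  have hid : ‖cexp (2 * π * I * y) - 1‖ = 2 * |Real.sin (π * y)| := by
    have e : (2 * π * I * y : ℂ) = I * ((2 * π * y : ℝ) : ℂ) := by push_cast; ring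
    rw [e, Complex.norm_exp_I_mul_ofReal_sub_one]
    rw [Real.norm_eq_abs, abs_mul, abs_two]
    congr 2
    ring
  rw [hid]
  -- Jordan: `|sin(π y)| ≥ 2|y|` for `|y| ≤ 1/2`
  have hj : 2 * |y| ≤ |Real.sin (π * y)| := by
    have h1 : 0 ≤ π * |y| := by positivity
    have h2 : π * |y| ≤ π / 2 := by nlinarith [Real.pi_pos]
    have h3 := Real.mul_le_sin h1 h2
    have h4 : 2 / π * (π * |y|) = 2 * |y| := by field_simp
    rw [h4] at h3
    have h5 : Real.sin (π * |y|) = |Real.sin (π * y)| := by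
      rcases le_or_gt 0 y with h0 | h0
      · have hy' : y ≤ 1 / 2 := (le_abs_self y).trans hyb
        rw [abs_of_nonneg h0, abs_of_nonneg]
        exact Real.sin_nonneg_of_nonneg_of_le_pi (by positivity) (by nlinarith [Real.pi_pos])
      · have hy' : -y ≤ 1 / 2 := (neg_le_abs y).trans hyb
        rw [abs_of_neg h0, mul_neg, Real.sin_neg, abs_of_neg]
        have : 0 < Real.sin (π * -y) := Real.sin_pos_of_pos_of_lt_pi (by nlinarith [Real.pi_pos])
          (by nlinarith [Real.pi_pos])
        rw [mul_neg] at this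
        rw [Real.sin_neg] at this
        linarith
    rw [← h5]
    exact h3
  linarith

/-! ### A one-dimensional comparison lemma (BBDF, proof of Lemma 4.5) -/

/-- **If `χ' = iaχ + O(E)` on `[0, Φ]` then `χ(Φ) = e^{iaΦ} χ(0) + O(EΦ)`** (mean value inequality
for `e^{-ias} χ(s)`). [cite: BachmannEtAl2019, proof of Lemma 4.5] -/
theorem norm_sub_cexp_mul_le_of_hasDerivAt {f f' : ℝ → ℂ} {a E Φ : ℝ} (hΦ : 0 ≤ Φ)
    (hf : ∀ s ∈ Set.Icc 0 Φ, HasDerivAt f (f' s) s)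
    (hE : ∀ s ∈ Set.Icc 0 Φ, ‖f' s - I * a * f s‖ ≤ E) :
    ‖f Φ - cexp (I * a * Φ) * f 0‖ ≤ E * Φ := by
  set g : ℝ → ℂ := fun s => cexp (-(I * a * s)) * f s with hg
  have hgd : ∀ s ∈ Set.Icc 0 Φ, HasDerivAt g (cexp (-(I * a * s)) * (f' s - I * a * f s)) s := by
    intro s hs
    have h1 : HasDerivAt (fun s : ℝ => cexp (-(I * a * s))) (cexp (-(I * a * s)) * (-(I * a))) s := by
      have h := ((hasDerivAt_id (s : ℂ)).const_mul (I * a)).neg.cexp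
      have h' := h.comp_ofReal
      simp only [id, mul_one] at h'
      exact h'
    have h := h1.mul (hf s hs)
    refine h.congr_deriv ?_
    ring
  have hbound : ∀ s ∈ Set.Icc 0 Φ, ‖cexp (-(I * a * s)) * (f' s - I * a * f s)‖ ≤ E := by
    intro s hs
    rw [norm_mul]
    have : ‖cexp (-(I * a * s))‖ = 1 := by
      have e : (-(I * a * s) : ℂ) = ((-(a * s) : ℝ) : ℂ) * I := by push_cast; ring
      rw [e, Complex.norm_exp_ofReal_mul_I]
    rw [this, one_mul]
    exact hE s hs
  have hMVT := Convex.norm_image_sub_le_of_norm_hasDerivWithin_le (f := g) (s := Set.Icc 0 Φ) (C := E)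
    (fun s hs => (hgd s hs).hasDerivWithinAt) hbound (convex_Icc 0 Φ)
    (Set.left_mem_Icc.2 hΦ) (Set.right_mem_Icc.2 hΦ)
  have hg0 : g 0 = f 0 := by simp [hg]
  have hgΦ : g Φ = cexp (-(I * a * Φ)) * f Φ := rfl
  rw [hg0, hgΦ, Real.norm_eq_abs, sub_zero, abs_of_nonneg hΦ] at hMVT
  have e : f Φ - cexp (I * a * Φ) * f 0 = cexp (I * a * Φ) * (cexp (-(I * a * Φ)) * f Φ - f 0) := by
    rw [mul_sub, ← mul_assoc, ← Complex.exp_add, add_neg_cancel, Complex.exp_zero, one_mul]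
  rw [e, norm_mul]
  have : ‖cexp (I * a * Φ)‖ = 1 := by
    have e : (I * a * Φ : ℂ) = ((a * Φ : ℝ) : ℂ) * I := by push_cast; ring
    rw [e, Complex.norm_exp_ofReal_mul_I]
  rw [this, one_mul]
  exact hMVT

/-! ### Symmetries and exponentials -/

omit [DecidableEq n] in
/-- **Expectations are invariant under a symmetry of the state**: if `Uψ = λψ` with `|λ| = 1` then
`⟨ψ, Uᴴ X U ψ⟩ = ⟨ψ, X ψ⟩`. [folklore] -/
theorem expect_conjTranspose_mul_mul {U X : Matrix n n ℂ} {ψ : n → ℂ} {lam : ℂ}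
    (hUψ : U *ᵥ ψ = lam • ψ) (hlam : ‖lam‖ = 1) :
    star ψ ⬝ᵥ ((Uᴴ * X * U) *ᵥ ψ) = star ψ ⬝ᵥ (X *ᵥ ψ) := by
  rw [← mulVec_mulVec, ← mulVec_mulVec, hUψ, mulVec_smul, dotProduct_mulVec, ← star_mulVec, hUψ,
    star_smul, smul_dotProduct, dotProduct_smul, smul_eq_mul, smul_eq_mul, ← mul_assoc,
    Complex.star_def, Complex.conj_mul', hlam]
  simp

/-- **Unitary conjugation of the exponential**: `Uᴴ e^X U = e^{Uᴴ X U}` for `Uᴴ U = 1`. [folklore] -/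
theorem conjTranspose_mul_exp_mul {U : Matrix n n ℂ} (hU : Uᴴ * U = 1) (X : Matrix n n ℂ) :
    Uᴴ * NormedSpace.exp X * U = NormedSpace.exp (Uᴴ * X * U) := by
  have hinv : U⁻¹ = Uᴴ := Matrix.inv_eq_left_inv hU
  have hunit : IsUnit U := by
    rw [Matrix.isUnit_iff_isUnit_det]
    exact Matrix.isUnit_det_of_left_inverse hU
  rw [← hinv]
  exact (Matrix.exp_conj' U X hunit).symm

/-- **The exponential of a scaled idempotent**: `P² = P ⟹ e^{cP} = 1 + (e^c - 1) P`. In particular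
`e^{2πiP} = 1` (integer spectrum). [folklore] -/
theorem exp_smul_of_mul_self_eq {P : Matrix n n ℂ} (hP : P * P = P) (c : ℂ) :
    NormedSpace.exp (c • P) = 1 + (cexp c - 1) • P := by
  set K : Matrix n n ℂ := c • P with hK
  have hKP : K * P = c • P := by rw [hK, smul_mul_assoc, hP]
  have hK1P : K * (1 - P) = 0 := by rw [Matrix.mul_sub, Matrix.mul_one, hKP, hK, sub_self]
  -- `w ↦ e^{wK}(1 - P)` and `w ↦ e^{-wc} e^{wK} P` are constant
  set F₁ : ℂ → Matrix n n ℂ := fun w => NormedSpace.exp (w • K) * (1 - P) with hF₁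
  set F₂ : ℂ → Matrix n n ℂ := fun w => cexp (-(w * c)) • (NormedSpace.exp (w • K) * P) with hF₂
  have hcommK : ∀ w : ℂ, K * NormedSpace.exp (w • K) = NormedSpace.exp (w • K) * K := fun w =>
    (((Commute.refl K).smul_right w).exp_right).eq
  have hF₁d : ∀ w, HasDerivAt F₁ 0 w := by
    intro w
    have h := (hasDerivAt_exp_smul_const' (𝕂 := ℂ) K w).mul_const (1 - P)
    refine h.congr_deriv ?_
    rw [hcommK, Matrix.mul_assoc, hK1P, Matrix.mul_zero]
  have hF₂d : ∀ w, HasDerivAt F₂ 0 w := by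
    intro w
    have h1 : HasDerivAt (fun w : ℂ => cexp (-(w * c))) (cexp (-(w * c)) * -c) w := by
      have := ((hasDerivAt_id w).mul_const c).neg.cexp
      simpa using this
    have h2 : HasDerivAt (fun w : ℂ => NormedSpace.exp (w • K) * P) (K * NormedSpace.exp (w • K) * P) w :=
      (hasDerivAt_exp_smul_const' (𝕂 := ℂ) K w).mul_const P
    have h := h1.smul h2
    refine h.congr_deriv ?_
    rw [hcommK, Matrix.mul_assoc, hKP, Matrix.mul_smul, smul_smul, ← add_smul]
    ring_nf
    rw [zero_smul]
  have hF₁c : F₁ 1 = F₁ 0 :=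
    is_const_of_deriv_eq_zero (fun w => (hF₁d w).differentiableAt) (fun w => (hF₁d w).deriv) 1 0
  have hF₂c : F₂ 1 = F₂ 0 :=
    is_const_of_deriv_eq_zero (fun w => (hF₂d w).differentiableAt) (fun w => (hF₂d w).deriv) 1 0
  simp only [hF₁, hF₂, one_smul, zero_smul, NormedSpace.exp_zero, one_mul,
    zero_mul, neg_zero, Complex.exp_zero] at hF₁c hF₂c
  -- `e^K P = e^c P`
  have hEP : NormedSpace.exp K * P = cexp c • P := by
    have h := congrArg (fun M => cexp c • M) hF₂c
    simp only [smul_smul, ← Complex.exp_add, add_neg_cancel, Complex.exp_zero, one_smul] at h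
    exact h
  calc NormedSpace.exp K = NormedSpace.exp K * P + NormedSpace.exp K * (1 - P) := by
        rw [← Matrix.mul_add, add_sub_cancel, Matrix.mul_one]
    _ = cexp c • P + (1 - P) := by rw [hEP, hF₁c]
    _ = 1 + (cexp c - 1) • P := by rw [sub_smul, one_smul]; abel

/-- `e^{2πi P} = 1` for an idempotent `P` (e.g. a number operator, a product of commuting number
operators). [folklore] -/
theorem exp_two_pi_I_smul_of_mul_self_eq {P : Matrix n n ℂ} (hP : P * P = P) :
    NormedSpace.exp ((2 * π * I) • P) = 1 := by
  rw [exp_smul_of_mul_self_eq hP, Complex.exp_two_pi_mul_I, sub_self, zero_smul, add_zero]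

end Literature.MathematicalPhysics.QuantumLattice

end
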